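import Mathlib
import HarnessLib
import Summits.ValiantsHypothesis.ValiantsHypothesis.Theses.ValuativeGCT
import Summits.ValiantsHypothesis.ValiantsHypothesis.Theorems.ValuativeGCTTailFlipStubIsobaricInheritance
import Summits.ValiantsHypothesis.ValiantsHypothesis.Theorems.ValuativeGCTTailFlipStubIsobaricSizeLift
import Summits.ValiantsHypothesis.ValiantsHypothesis.Theorems.ValuativeGCTValuativeFlipTailSuffices
import Literature.Computability.Complexity.OccurrenceObstructionsIPProofs
import Summits.ValiantsHypothesis.ValiantsHypothesis.Theorems.TailFlip.Negative.TailFlipKillTransfer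

/-!
# `ValuativeGCT.TailFlip` (stmt-ValiantsHypothesis-15687), line `Sketch` (isobaric anchors):
# the composition of the line and the strength of its residual stub

The skeleton of the line (`Cruxes/TailFlip/Lines/Sketch.lean`) reduces the crux `TailFlip` to ONE open
stub, `stub_isobaricTailCensus` (anchored isobaric certificates of size `D` at an anchor permanent `per_K`
together with an admissible centre `(U, r)` whose valuative truncation at the doubly row-lifted shape has
dimension `< D`, at every position of the tail window).  This file makes that reduction a tree fact and
records, sorry-free, how strong the stub is:

* `tailFlip_of_isobaricTailCensus` — **stub ⇒ `TailFlip`** (the skeleton's `TailFlip_of`: substitute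
  `N = K + i`, bound the padded-permanent multiplicity from below by anchored inheritance — the landed
  stubs `stub_isobaricSizeLift` (size lift `K ↦ K + i` by the block `per_K ⊕ x_t·I_i`) and
  `stub_isobaricInheritance` (the isobaric engine at padding `j`), composed exactly as in the landed
  `anchored_le_orbitMultiplicity` — and compare with the census);
* `isobaricTailCensus_strength` — **stub ⇒ `ValuativeFlip` ∧ `DcPerSuperpolynomial ℂ` ∧ (no border
  determinantal expression of `X₀₀^(m-n) per_n` anywhere in the tail window, eventually in `n`)**, by the
  landed `Theorems.ValuativeFlip.valuativeFlip_of_tailFlip` (the tail child is the whole parent crux),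
  `Negative.dcPerSuperpolynomial_of_tailFlip` and `Negative.tailFlip_border`.

So the residual stub of the line is at least as strong as the parent crux `ValuativeFlip` and proves
Valiant's hypothesis in determinantal-complexity form: it is crux-sized (indeed summit-sized), which is the
lead's evidence for handing it back rather than sub-decomposing it (D-0019/L4).  No new definitions; the
stub is carried as a verbatim hypothesis.

Sources: this crux, `Cruxes/TailFlip/Lines/Sketch.{lean,md}`, `Cruxes/TailFlip/Ideas/isobaric-anchors.md`;
Bürgisser–Ikenmeyer–Panova, J. AMS 32 (2019) Lemma 5.2, Thm 5.4; Ikenmeyer–Panova 2017 (arXiv:1512.03798)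
Prop. 2.6(b); Mulmuley–Sohoni, SIAM J. Comput. 31 (2001) §4; Bläser–Ikenmeyer 2025 §12.4.
-/

set_option linter.dupNamespace false

namespace Summit.ValiantsHypothesis.ValiantsHypothesis.Theorems.TailFlip

open MvPolynomial
open scoped BigOperators Matrix
open Literature.NumberTheory.DiophantineGeometry
open Literature.Computability.AlgebraicComplexity
open Literature.Computability.Complexity
open Summit.ValiantsHypothesis.ValiantsHypothesis.Theses.ValuativeGCT

noncomputable section

/-- **The line's composition: `stub_isobaricTailCensus ⇒ TailFlip`.**  Hypothesis (verbatim the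
registered stub of line `Sketch`): for every slope `a/b > 1` and every `c`, eventually in `N`, at every
tail position `m = N + j` (`a·N < b·m ≤ 2^((log₂ N + c)^c)`) there are an anchor size `K ≥ 1` with
`K + i = N`, a degree `δ`, a shape `μ ⊢ Kδ` with `≤ K²` parts, inner highest-weight vectors `F₁ … F_D`
of weight `μ*` on `ℂ[Sym^K ℂ^{K²}]`, `x_t`-isobaric inner points `A_l · per_K` with nonsingular
untwisted evaluation matrix, and an admissible centre `(U, r)` at size `K + i + j` whose valuative
truncation at degree `δ` and weight `((μ♯(K+i))♯(K+i+j))*` has dimension `< D`.  Conclusion: the crux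
`TailFlip` by name — the witness is `(U, r, δ, (μ♯(K+i))♯(K+i+j))`, and
`D ≤ mult ℂ[Δ_{K+i+j}(X₀₀^j per_{K+i})]` at that weight is anchored inheritance
(`stub_isobaricSizeLift`, then `stub_isobaricInheritance`; = the landed `anchored_le_orbitMultiplicity`).
[this crux, Cruxes/TailFlip/Lines/Sketch.lean `TailFlip_of`; arXiv:1512.03798 Prop. 2.6(b)] -/
theorem tailFlip_of_isobaricTailCensus :
    (∀ a b : ℕ, b < a → ∀ c : ℕ, ∃ n₀ : ℕ, ∀ N ≥ n₀, ∀ (j : ℕ),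
      a * N < b * (N + j) → N + j ≤ 2 ^ ((Nat.log 2 N + c) ^ c) →
      ∃ (K i : ℕ) (_ : NeZero K) (_ : K + i = N) (δ : ℕ) (μ : Nat.Partition (K * δ)) (D : ℕ)
        (F : Fin D → MvPolynomial (DegIdx (MatIdx K) K) ℂ) (A : Fin D → Matrix (MatIdx K) (MatIdx K) ℂ)
        (e₀ : Fin D → ℕ) (U : Submodule ℂ (MatIdx (K + i + j) → ℂ)) (r : ℕ),
        μ.parts.card ≤ K * K ∧
        (∀ i', F i' ∈ highestWeightSpace (coordRep (MatIdx K) ℂ K) (partitionWeightLex K μ)) ∧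
        (∀ l, ∀ e ∈ (linSubst (MatIdx K) ℂ (A l) (paddedPerFormLex ℂ K K)).support, e (topMatIdx K) = e₀ l) ∧
        (Matrix.of fun i' l : Fin D => MvPolynomial.aeval
            (fun e : DegIdx (MatIdx K) K =>
              MvPolynomial.coeff e.1 (linSubst (MatIdx K) ℂ (A l) (paddedPerFormLex ℂ K K))) (F i')).det ≠ 0 ∧
        (∀ u ∈ U, (Matrix.of fun a b : Fin (K + i + j) => u (toLex (a, b))).rank ≤ r) ∧
        Module.finrank ℂ ↥(MvPolynomial.homogeneousSubmodule (MatIdx (K + i + j) × MatIdx (K + i + j)) ℂ ((K + i + j) * δ) ⊓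
            ((MvPolynomial.vanishingIdeal ℂ {p : MatIdx (K + i + j) × MatIdx (K + i + j) → ℂ |
                ∀ j' : MatIdx (K + i + j), (fun i => p (j', i)) ∈ U}) ^ (δ * ((K + i + j) - r))).restrictScalars ℂ ⊓
            (⨅ (M : Matrix (MatIdx (K + i + j)) (MatIdx (K + i + j)) ℂ)
              (_ : linSubst (MatIdx (K + i + j)) ℂ M (detFormLex ℂ (K + i + j)) = detFormLex ℂ (K + i + j)),
              LinearMap.ker ((MvPolynomial.aeval (R := ℂ) fun p : MatIdx (K + i + j) × MatIdx (K + i + j) =>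
                  ∑ l : MatIdx (K + i + j), M l p.2 • MvPolynomial.X (p.1, l)).toLinearMap -
                LinearMap.id (R := ℂ) (M := MvPolynomial (MatIdx (K + i + j) × MatIdx (K + i + j)) ℂ))) ⊓
            (⨅ (g : Matrix.GeneralLinearGroup (MatIdx (K + i + j)) ℂ) (_ : IsUpperTriangular g),
              LinearMap.ker ((MvPolynomial.aeval (R := ℂ) fun p : MatIdx (K + i + j) × MatIdx (K + i + j) =>
                  ∑ l : MatIdx (K + i + j), ((g⁻¹ : Matrix.GeneralLinearGroup (MatIdx (K + i + j)) ℂ) :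
                    Matrix (MatIdx (K + i + j)) (MatIdx (K + i + j)) ℂ) p.1 l • MvPolynomial.X (l, p.2)).toLinearMap -
                weightChar (partitionWeightLex (K + i + j) (rowLift (rowLift μ i) j)) g •
                  LinearMap.id (R := ℂ) (M := MvPolynomial (MatIdx (K + i + j) × MatIdx (K + i + j)) ℂ)))) < D) →
    Summit.ValiantsHypothesis.ValiantsHypothesis.Theses.ValuativeGCT.TailFlip := by
  intro h a b hba c
  obtain ⟨n₀, hn₀⟩ := h a b hba c
  refine ⟨n₀, fun N hN m _ hlt hm => ?_⟩
  have hNm : N < m := Negative.lt_of_slope hba hlt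
  obtain ⟨j, rfl⟩ : ∃ j, m = N + j := ⟨m - N, by omega⟩
  obtain ⟨K, i, hK, hKi, δ, μ, D, F, A, e₀, U, r, hμ, hF, hiso, hdet, hU, hcensus⟩ := hn₀ N hN j hlt hm
  subst hKi
  have hK1 : 1 ≤ K := Nat.one_le_iff_ne_zero.2 (NeZero.ne K)
  haveI : NeZero (K + i) := ⟨by omega⟩
  have hKK : 1 ≤ K * K := Nat.one_le_iff_ne_zero.2 (mul_ne_zero (NeZero.ne K) (NeZero.ne K))
  -- the per-side half (= the landed `anchored_le_orbitMultiplicity`, p118501, inlined: size lift, then the engine)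
  have hμ' : (rowLift μ i).parts.card ≤ (K + i) * (K + i) :=
    (card_parts_rowLift_le μ i).trans
      (max_le (hμ.trans (Nat.mul_le_mul (Nat.le_add_right K i) (Nat.le_add_right K i)))
        (Nat.one_le_iff_ne_zero.2 (mul_ne_zero (NeZero.ne (K + i)) (NeZero.ne (K + i)))))
  obtain ⟨F', A', hF', hiso', hdet'⟩ := stub_isobaricSizeLift K i δ μ hμ D F hF A e₀ hiso hdet
  have hD : D ≤ orbitMultiplicity ℂ (paddedPerFormLex ℂ (K + i) (K + i + j)) (K + i + j)
      (partitionWeightLex (K + i + j) (rowLift (rowLift μ i) j)) :=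
    stub_isobaricInheritance (K + i) j δ (rowLift μ i) hμ' D F' hF' A' (fun l => e₀ l + i) hiso' hdet'
  -- the shape has few enough parts
  have hparts : (rowLift (rowLift μ i) j).parts.card ≤ (K + i + j) * (K + i + j) := by
    have h1 : (rowLift μ i).parts.card ≤ K * K := (card_parts_rowLift_le μ i).trans (max_le hμ hKK)
    have h2 : (rowLift (rowLift μ i) j).parts.card ≤ K * K :=
      (card_parts_rowLift_le _ j).trans (max_le h1 hKK)
    exact h2.trans (Nat.mul_le_mul (by omega) (by omega))
  refine ⟨U, r, δ, rowLift (rowLift μ i) j, hU, hparts, ?_⟩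
  intro χ T
  exact lt_of_lt_of_le hcensus hD

/-- **Strength of the residual stub.**  Under the same hypothesis (the registered stub
`stub_isobaricTailCensus` of line `Sketch`, verbatim): the parent crux `ValuativeFlip` holds (the tail
child is the whole crux, `Theorems.ValuativeFlip.valuativeFlip_of_tailFlip`), Valiant's hypothesis holds in
determinantal-complexity form (`DcPerSuperpolynomial ℂ`, via `Negative.dcPerSuperpolynomial_of_tailFlip`),
and, eventually in `n`, no position `(n, m)` of any tail window carries a border determinantal
expression of the padded permanent (`¬ HasBorderDetRepr ℂ n m`, via `Negative.tailFlip_border`).  Hence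
the stub is crux-sized — indeed summit-sized: any proof of it is a proof of `VNP ⊄ VP_ws` over `ℂ` by
multiplicity obstructions. [this file; Mulmuley–Sohoni 2001 §4; Bläser–Ikenmeyer 2025 §12.4] -/
theorem isobaricTailCensus_strength :
    (∀ a b : ℕ, b < a → ∀ c : ℕ, ∃ n₀ : ℕ, ∀ N ≥ n₀, ∀ (j : ℕ),
      a * N < b * (N + j) → N + j ≤ 2 ^ ((Nat.log 2 N + c) ^ c) →
      ∃ (K i : ℕ) (_ : NeZero K) (_ : K + i = N) (δ : ℕ) (μ : Nat.Partition (K * δ)) (D : ℕ)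
        (F : Fin D → MvPolynomial (DegIdx (MatIdx K) K) ℂ) (A : Fin D → Matrix (MatIdx K) (MatIdx K) ℂ)
        (e₀ : Fin D → ℕ) (U : Submodule ℂ (MatIdx (K + i + j) → ℂ)) (r : ℕ),
        μ.parts.card ≤ K * K ∧
        (∀ i', F i' ∈ highestWeightSpace (coordRep (MatIdx K) ℂ K) (partitionWeightLex K μ)) ∧
        (∀ l, ∀ e ∈ (linSubst (MatIdx K) ℂ (A l) (paddedPerFormLex ℂ K K)).support, e (topMatIdx K) = e₀ l) ∧
        (Matrix.of fun i' l : Fin D => MvPolynomial.aeval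
            (fun e : DegIdx (MatIdx K) K =>
              MvPolynomial.coeff e.1 (linSubst (MatIdx K) ℂ (A l) (paddedPerFormLex ℂ K K))) (F i')).det ≠ 0 ∧
        (∀ u ∈ U, (Matrix.of fun a b : Fin (K + i + j) => u (toLex (a, b))).rank ≤ r) ∧
        Module.finrank ℂ ↥(MvPolynomial.homogeneousSubmodule (MatIdx (K + i + j) × MatIdx (K + i + j)) ℂ ((K + i + j) * δ) ⊓
            ((MvPolynomial.vanishingIdeal ℂ {p : MatIdx (K + i + j) × MatIdx (K + i + j) → ℂ |
                ∀ j' : MatIdx (K + i + j), (fun i => p (j', i)) ∈ U}) ^ (δ * ((K + i + j) - r))).restrictScalars ℂ ⊓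
            (⨅ (M : Matrix (MatIdx (K + i + j)) (MatIdx (K + i + j)) ℂ)
              (_ : linSubst (MatIdx (K + i + j)) ℂ M (detFormLex ℂ (K + i + j)) = detFormLex ℂ (K + i + j)),
              LinearMap.ker ((MvPolynomial.aeval (R := ℂ) fun p : MatIdx (K + i + j) × MatIdx (K + i + j) =>
                  ∑ l : MatIdx (K + i + j), M l p.2 • MvPolynomial.X (p.1, l)).toLinearMap -
                LinearMap.id (R := ℂ) (M := MvPolynomial (MatIdx (K + i + j) × MatIdx (K + i + j)) ℂ))) ⊓
            (⨅ (g : Matrix.GeneralLinearGroup (MatIdx (K + i + j)) ℂ) (_ : IsUpperTriangular g),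
              LinearMap.ker ((MvPolynomial.aeval (R := ℂ) fun p : MatIdx (K + i + j) × MatIdx (K + i + j) =>
                  ∑ l : MatIdx (K + i + j), ((g⁻¹ : Matrix.GeneralLinearGroup (MatIdx (K + i + j)) ℂ) :
                    Matrix (MatIdx (K + i + j)) (MatIdx (K + i + j)) ℂ) p.1 l • MvPolynomial.X (l, p.2)).toLinearMap -
                weightChar (partitionWeightLex (K + i + j) (rowLift (rowLift μ i) j)) g •
                  LinearMap.id (R := ℂ) (M := MvPolynomial (MatIdx (K + i + j) × MatIdx (K + i + j)) ℂ)))) < D) →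
    Summit.ValiantsHypothesis.ValiantsHypothesis.Theses.ValuativeGCT.ValuativeFlip ∧ DcPerSuperpolynomial ℂ ∧
      (∀ a b : ℕ, b < a → ∀ c : ℕ, ∃ n₀ : ℕ, ∀ n ≥ n₀, ∀ (m : ℕ) [NeZero m],
        a * n < b * m → m ≤ 2 ^ ((Nat.log 2 n + c) ^ c) → ¬ HasBorderDetRepr ℂ n m) := by
  intro h
  have hT : TailFlip := tailFlip_of_isobaricTailCensus h
  exact ⟨Summit.ValiantsHypothesis.ValiantsHypothesis.Theorems.ValuativeFlip.valuativeFlip_of_tailFlip hT,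
    Negative.dcPerSuperpolynomial_of_tailFlip hT, Negative.tailFlip_border hT⟩

end

end Summit.ValiantsHypothesis.ValiantsHypothesis.Theorems.TailFlip
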